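import Literature.NumberTheory.EllipticCurves.LocalEulerCharacteristicTorsion
import HarnessLib

/-!
# `H¹(K_v, E)[p^∞]` has BOUNDED EXPONENT at every finite place `v ∤ p` — the local binder hbd of
# the (Lℓ) lemma is a THEOREM (cell `b2b-bsdres`, team n1011, row T-a3-F1 (B4); seat n1011-p05
# gen 2, PROPOSED ROW T-a3-F1-B4 under R3-25 (f))

HONEST FRAMING (cell `b2b-bsdres`, run/shared/lean/b2b/bsd-rank1-residual/, verbatim in every
file): the goal of the cell is to DELETE the COMBINATION-SHAPED residual classes of the
Birch–Swinnerton-Dyer formula for ALL analytic-rank `≤ 1` elliptic curves over `ℚ` — "full BSD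
formula for every rank `≤ 1` curve in class `C`" assembled STRICTLY from published theorems — so
that the rank-`≤ 1` remainder becomes exactly the CONSTRUCTION-SHAPED classes, which are TYPED
(missing-input `Prop`s), NOT attempted. This is not "finishing BSD". Team n1011 (X4 ∧ `p = 3`,
§I N11; row T-a3-F1 = the hypothesis side of Sakamoto 2024 Thm. 4.4 for `(E[3^{k+1}], 𝓕_can)`):
research route; theorems only; no definition, no named fact; nothing booked; no label changes.

## What and why

n1011-p06's (Lℓ) lemma `propagatedSelmerStructureOne_inr_eq_kummerSelmerStructure`
(`PropagatedStructureKummerEq.lean`), n1011-p13's core-rank count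
(`hasCoreRank_one_propagatedSelmerStructureOne`) and this seat's level-`k` sandwich / unramifiedness
files (`PropagatedStructureKummerLevel.lean`, `PropagatedStructureUnramified.lean`) all carry the
explicit local binder

  hbd(v) : `∃ N, ∀ c ∈ H¹(ℚ_v, E(ℚ̄_v)), (∃ j, p^j • c = 0) → p^N • c = 0`

("the `p`-power torsion of `H¹(ℚ_v, E)` has bounded exponent"), recorded as "TRUE at `v ∤ p` by
Tate local duality, not a tree theorem".  It IS a tree theorem: the Literature library proves
Tate's local Euler–Poincaré characteristic for `ℓ`-PRIMARY modules at residue characteristic `≠ ℓ`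
(`natCard_invariants_mul_natCard_two_eq`, `PrimeToPEulerChar.lean`: `#A^{Γ_F} · #H²(F, A) = #H¹(F, A)`,
via `cd_ℓ` of the inertia and of `Γ/I`), the bidegree-`(2,0)` duality with the Weil pairing
(`natCard_galoisCohomology_two_torsion_restrictField`: `#H²(K_v, E[n]) = #E(K_v)[n]`), the
invariants count (`natCard_invariants_torsion_restrictField`: `#H⁰ = #E(K_v)[n]`), the exact local
Kummer sequence count (`natCard_torsionBy_galoisCohomology_localGaloisModule_mul`:
`#H¹(K_v, E)[n] · #E(K_v)[n] · #(𝓞_v/n) = #H¹(K_v, E[n])`) and Milne I Lemma 3.3's finite-index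
torsion-free subgroup of `E(K_v)` (`exists_finiteIndex_torsionFree_adicCompletion`).  Assembled
here, for an elliptic curve `E = W` over ANY number field `K`, a prime `p` and a finite place
`v ∤ p` (no reduction hypothesis):

* `natCard_galoisCohomology_one_torsion_adicCompletion_eq_sq_of_not_mem` —
  **`#H¹(K_v, E[p^{m+1}]) = #E(K_v)[p^{m+1}]²`**, UNCONDITIONAL (Milne I Thm. 2.8 for `M = E[p^{m+1}]`
  at `v ∤ p`, where `(𝓞_v : p𝓞_v) = 1`);
* `natCard_quot_adicCompletionIntegers_eq_one_of_not_mem` — `#(𝓞_v / n𝓞_v) = 1` for `v ∤ n`;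
* `natCard_torsionBy_galoisCohomology_localGaloisModule_eq_of_not_mem` —
  **`#H¹(K_v, E)[p^{m+1}] = #E(K_v)[p^{m+1}]`**, UNCONDITIONAL: the ORDER form of Tate local duality
  for `E` at `v ∤ p` (Milne I Cor. 3.4: `H¹(K_v, E)[n] ≅ (E(K_v)/n)^*`, and `E(K_v)/n ≅ E(K_v)[n]`
  in order at `v ∤ n`);
* `exists_natCard_ker_nsmul_adicCompletion_le` — a uniform bound `#E(K_v)[n] ≤ B` (`n ≠ 0`);
* `exists_pow_smul_eq_zero_galoisCohomology_localGaloisModule` — **hbd(v) at every `v ∤ p`**: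
  `∃ N, ∀ c ∈ H¹(K_v, E), (∃ j, p^j • c = 0) → p^N • c = 0`;
* `bounded_pPrimaryTorsion_localGaloisModule_rat` — the same over `ℚ` in n1011-p06's spelling
  (`Place.Completion (Sum.inr v : Place ℚ)`), i.e. p06's / p13's binder hbd VERBATIM, discharged.

Consumers: p06's `propagatedSelmerStructureOne_inr_eq_kummerSelmerStructure … (hbd)` and p13's
`hasCoreRank_one_propagatedSelmerStructureOne … (hbd)` lose that binder; the sibling
`PropagatedStructureUnramified.lean` discharges p13's `hunr`/`hS'` with NO local binder left.

References: J. S. Milne, *Arithmetic Duality Theorems* I Thm. 2.8, Lemma 3.3, Thm. 3.2, Cor. 3.4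
[MilneADT2006]; J.-P. Serre, *Galois Cohomology* II §5 [SerreGaloisCohomology1997]; J. H. Silverman,
*AEC* VII.6.3, VIII.§2, X.§4 [SilvermanAEC2009].
-/

noncomputable section

open scoped Classical NumberField

universe u

namespace Summit.BirchSwinnertonDyer.Rank1Residual.GaloisImage

open Field ValuativeRel NumberField IsDedekindDomain WeierstrassCurve
open Literature.NumberTheory.EllipticCurves Literature.NumberTheory.GaloisRepresentations
open scoped ContRepresentation

variable {K : Type u} [Field K] [NumberField K] (W : WeierstrassCurve K) [W.IsElliptic]
variable (v : HeightOneSpectrum (𝓞 K)) (p : ℕ) [hp : Fact p.Prime]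

/-! ## §1. The residue characteristic of `K_v` is not `p` when `v ∤ p` -/

omit [W.IsElliptic] hp in
/-- For `v ∤ p` the residue characteristic of `K_v` (for the `ValuativeRel` structure of
`AdicCompletionLocalField`) is not `p`: otherwise `p ≡ 0` in the residue field, so `p` is a non-unit
of `𝒪[K_v]`, i.e. `v(p) < 1`, i.e. `p ∈ v` (same argument as the tree's
`not_ringChar_residueField_adicCompletion_dvd`). [folklore] -/
theorem ringChar_residueField_adicCompletion_ne_of_not_mem (hpv : ((p : ℕ) : 𝓞 K) ∉ v.asIdeal) :
    p ≠ ringChar 𝓀[v.adicCompletion K] := by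
  intro h
  have h0 : ((p : ℕ) : 𝓀[v.adicCompletion K]) = 0 :=
    (ringChar.spec 𝓀[v.adicCompletion K] p).2 (h ▸ dvd_refl p)
  have h1 : ¬ IsUnit ((p : ℕ) : 𝒪[v.adicCompletion K]) := fun hu => by
    have h' := hu.map (IsLocalRing.residue 𝒪[v.adicCompletion K])
    rw [map_natCast] at h'
    exact h'.ne_zero h0
  rw [Valuation.Integer.not_isUnit_iff_valuation_lt_one] at h1
  have h2 : Valued.v (((p : ℕ) : 𝒪[v.adicCompletion K]) : v.adicCompletion K) < 1 :=
    (Valuation.vlt_one_iff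
      (Valued.v : Valuation (v.adicCompletion K) (WithZero (Multiplicative ℤ)))).mp
      ((Valuation.vlt_one_iff (ValuativeRel.valuation (v.adicCompletion K))).mpr h1)
  have h3 : (((p : ℕ) : 𝒪[v.adicCompletion K]) : v.adicCompletion K) =
      ((algebraMap (𝓞 K) K p : K) : v.adicCompletion K) := by
    rw [SubringClass.coe_natCast, map_natCast]
    exact (map_natCast (algebraMap K (v.adicCompletion K)) p).symm
  rw [h3, HeightOneSpectrum.valuedAdicCompletion_eq_valuation',
    HeightOneSpectrum.valuation_lt_one_iff_mem] at h2
  exact hpv h2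

/-! ## §2. `#H¹(K_v, E[p^{m+1}]) = #E(K_v)[p^{m+1}]²` and `#H¹(K_v, E)[p^{m+1}] = #E(K_v)[p^{m+1}]` at `v ∤ p` -/

/-- **`#H¹(K_v, E[p^{m+1}]) = #E(K_v)[p^{m+1}]²` at a finite place `v ∤ p`, UNCONDITIONALLY**:
Tate's local Euler–Poincaré characteristic for the `p`-primary module `E[p^{m+1}]` at residue
characteristic `≠ p` is the tree THEOREM `natCard_invariants_mul_natCard_two_eq`
(`#M^{Γ} · #H² = #H¹`, `(𝓞_v : p𝓞_v) = 1`), with `#H⁰ = #H² = #E(K_v)[p^{m+1}]`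
(`natCard_invariants_torsion_restrictField`, `natCard_galoisCohomology_two_torsion_restrictField` —
bidegree-`(2,0)` duality + Weil pairing).  Milne I Thm. 2.8 for `M = E[n]`, `v ∤ n`.
[cite: MilneADT2006, Ch. I §2, Thm. 2.8 (p. 31)] [cite: SilvermanAEC2009, Prop. III.8.1] -/
theorem natCard_galoisCohomology_one_torsion_adicCompletion_eq_sq_of_not_mem
    (hpv : ((p : ℕ) : 𝓞 K) ∉ v.asIdeal) (m : ℕ) :
    Nat.card (galoisCohomology
        (GaloisRep.restrictField (v.adicCompletion K) (W.torsionGaloisModule (p ^ (m + 1) : ℕ))) 1) =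
      Nat.card (nsmulAddMonoidHom (p ^ (m + 1)) :
          (W.baseChange (v.adicCompletion K)).toAffine.Point →+ _).ker ^ 2 := by
  haveI : CharZero (v.adicCompletion K) := charZero_adicCompletion v
  haveI : NeZero (p ^ (m + 1)) := ⟨pow_ne_zero _ hp.out.ne_zero⟩
  -- `H²` needs `LocallyCompactSpace Γ_{K_v}` (compactness of absolute Galois groups, as an instance
  -- inside this proof only) and the finiteness of `E[p^{m+1}]`
  haveI := absoluteGaloisGroup_compactSpace (v.adicCompletion K)
  haveI : Finite (geomTorsion W ((p ^ (m + 1) : ℕ) : ℤ)) := finite_geomTorsion_of_neZero W (p ^ (m + 1))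
  -- (stated before `set F`, so that `set` rewrites its residue field to `𝓀[F]` syntactically)
  have hℓ : p ≠ ringChar 𝓀[v.adicCompletion K] :=
    ringChar_residueField_adicCompletion_ne_of_not_mem v p hpv
  set F := v.adicCompletion K with hF
  set ρ : ContinuousRep (absoluteGaloisGroup F) ℤ (geomTorsion W (p ^ (m + 1) : ℕ)) :=
    GaloisRep.restrictField F (W.torsionGaloisModule (p ^ (m + 1) : ℕ)) with hρ
  have hn : IsPrimePow (p ^ (m + 1)) := ⟨p, m + 1, hp.out.prime, m.succ_pos, rfl⟩
  -- `E[p^{m+1}]` is `p`-primary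
  have hA : IsPrimaryTorsion p (geomTorsion W ((p ^ (m + 1) : ℕ) : ℤ)) :=
    IsPrimaryTorsion.of_forall_nsmul_eq_zero (r := m + 1) fun T => AddSubgroup.torsionBy.nsmul T
  obtain ⟨-, hEq⟩ := natCard_invariants_mul_natCard_two_eq F ρ hA hℓ
  -- `#H⁰` and `#H²`
  have h0 : Nat.card ρ.toTopRep.ρ.invariants =
      Nat.card (nsmulAddMonoidHom (p ^ (m + 1)) : (W.baseChange F).toAffine.Point →+ _).ker :=
    natCard_invariants_torsion_restrictField W F (NeZero.ne _)
  have h2 : Nat.card (continuousCohomology 2 ρ.toTopRep) =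
      Nat.card (nsmulAddMonoidHom (p ^ (m + 1)) : (W.baseChange F).toAffine.Point →+ _).ker :=
    (natCard_galoisCohomology_two_torsion_restrictField W F (p ^ (m + 1)) hn).2
  change Nat.card (continuousCohomology 1 ρ.toTopRep) = _
  rw [← hEq, h0, h2, sq]

omit [W.IsElliptic] hp in
/-- `#(𝓞_v / n𝓞_v) = 1` for `v ∤ n`: `n` is a unit of `𝓞_v` (`v(n) = 1`, tree
`LocalPoints.valuation_natCast_eq_one`, `LocalPoints.isUnit_iff_valuation_eq_one`), so `(n) = 𝓞_v`.
[folklore] -/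
theorem natCard_quot_adicCompletionIntegers_eq_one_of_not_mem {n : ℕ} (hn : ((n : ℕ) : 𝓞 K) ∉ v.asIdeal) :
    Nat.card (v.adicCompletionIntegers K ⧸
        Ideal.span {(n : v.adicCompletionIntegers K)}) = 1 := by
  have hu : IsUnit (n : v.adicCompletionIntegers K) := by
    rw [LocalPoints.isUnit_iff_valuation_eq_one]
    have h := LocalPoints.valuation_natCast_eq_one v hn
    convert h using 2
    simp
  have htop : Ideal.span {(n : v.adicCompletionIntegers K)} = ⊤ := Ideal.span_singleton_eq_top.mpr hu
  haveI : Subsingleton (v.adicCompletionIntegers K ⧸ Ideal.span {(n : v.adicCompletionIntegers K)}) :=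
    Ideal.Quotient.subsingleton_iff.mpr htop
  exact Nat.card_of_subsingleton 0

/-- **`#H¹(K_v, E)[p^{m+1}] = #E(K_v)[p^{m+1}]` at a finite place `v ∤ p`, UNCONDITIONALLY** — the
order form of Tate local duality for `E` off `p` (Milne I Thm. 3.2 / Cor. 3.4:
`H¹(K_v, E)[n] ≅ (E(K_v)/nE(K_v))^*`, of order `#E(K_v)[n] · (𝓞_v : n𝓞_v) = #E(K_v)[n]` at `v ∤ n`,
Lemma 3.3): the exact local Kummer sequence count
`#H¹(K_v, E)[n] · #E(K_v)[n] · #(𝓞_v/n) = #H¹(K_v, E[n])` (tree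
`natCard_torsionBy_galoisCohomology_localGaloisModule_mul`) against
`natCard_galoisCohomology_one_torsion_adicCompletion_eq_sq_of_not_mem` and `#(𝓞_v/n) = 1`.
[cite: MilneADT2006, Ch. I, Thm. 3.2, Lemma 3.3 and Cor. 3.4] -/
theorem natCard_torsionBy_galoisCohomology_localGaloisModule_eq_of_not_mem
    (hpv : ((p : ℕ) : 𝓞 K) ∉ v.asIdeal) (m : ℕ) :
    Nat.card (AddSubgroup.torsionBy
        (galoisCohomology (W.localGaloisModule (v.adicCompletion K)) 1) ((p ^ (m + 1) : ℕ) : ℤ)) =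
      Nat.card (nsmulAddMonoidHom (p ^ (m + 1)) :
          (W.baseChange (v.adicCompletion K)).toAffine.Point →+ _).ker := by
  have hn0 : p ^ (m + 1) ≠ 0 := pow_ne_zero _ hp.out.ne_zero
  have hpm : (((p ^ (m + 1) : ℕ) : ℕ) : 𝓞 K) ∉ v.asIdeal := by
    rw [Nat.cast_pow]
    exact fun h => hpv (v.isPrime.mem_of_pow_mem (m + 1) h)
  have hmul := natCard_torsionBy_galoisCohomology_localGaloisModule_mul W v hn0
  rw [natCard_galoisCohomology_one_torsion_adicCompletion_eq_sq_of_not_mem W v p hpv m,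
    natCard_quot_adicCompletionIntegers_eq_one_of_not_mem v hpm, mul_one, sq] at hmul
  haveI := W.finite_ker_nsmul_adicCompletion v hn0
  exact Nat.eq_of_mul_eq_mul_right Nat.card_pos hmul

/-! ## §3. A uniform bound on `#E(K_v)[n]` and the bounded exponent of `H¹(K_v, E)[p^∞]` -/

omit hp in
/-- **`#E(K_v)[n] ≤ B` uniformly in `n ≠ 0`**: `E(K_v)` has a torsion-free subgroup `U` of finite
index (Silverman VII.6.3 / Milne I Lemma 3.3, tree `exists_finiteIndex_torsionFree_adicCompletion`),
and `E(K_v)[n]` injects into `E(K_v)/U`; `B = [E(K_v) : U]`.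
[cite: SilvermanAEC2009, Prop. VII.6.3] [cite: MilneADT2006, I Lemma 3.3] -/
theorem exists_natCard_ker_nsmul_adicCompletion_le :
    ∃ B : ℕ, 0 < B ∧ ∀ n : ℕ, n ≠ 0 →
      Nat.card (nsmulAddMonoidHom n : (W.baseChange (v.adicCompletion K)).toAffine.Point →+ _).ker ≤ B := by
  obtain ⟨U, hU, htf, -⟩ := W.exists_finiteIndex_torsionFree_adicCompletion v
  haveI := hU
  haveI : Finite ((W.baseChange (v.adicCompletion K)).toAffine.Point ⧸ U) :=
    AddSubgroup.finite_quotient_of_finiteIndex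
  refine ⟨U.index, Nat.pos_of_ne_zero hU.index_ne_zero, fun n hn => ?_⟩
  rw [AddSubgroup.index]
  refine Nat.card_le_card_of_injective
    (fun x : (nsmulAddMonoidHom n : (W.baseChange (v.adicCompletion K)).toAffine.Point →+ _).ker =>
      ((x : (W.baseChange (v.adicCompletion K)).toAffine.Point) : _ ⧸ U)) ?_
  rintro ⟨x, hx⟩ ⟨y, hy⟩ hxy
  apply Subtype.ext
  have hmem : -x + y ∈ U := QuotientAddGroup.eq.mp hxy
  rw [AddMonoidHom.mem_ker, nsmulAddMonoidHom_apply] at hx hy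
  have h0 : n • (-x + y) = 0 := by rw [nsmul_add, neg_nsmul, hx, hy, neg_zero, add_zero]
  have h := htf n hn _ hmem h0
  rwa [neg_add_eq_zero] at h

/-- **The `p`-power torsion of `H¹(K_v, E)` has bounded exponent at every finite `v ∤ p`**
(UNCONDITIONAL): `∃ N, ∀ c ∈ H¹(K_v, E(K̄_v)), (∃ j, p^j • c = 0) → p^N • c = 0`.  If `p^j • c = 0`
then `c` has order `p^i`, and for `i ≥ 1` the cyclic group `⟨c⟩ ≤ H¹(K_v, E)[p^i]` gives
`p^i ≤ #H¹(K_v, E)[p^i] = #E(K_v)[p^i] ≤ B` (`natCard_torsionBy_galoisCohomology_localGaloisModule_eq_of_not_mem`,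
`exists_natCard_ker_nsmul_adicCompletion_le`), so `i < B` and `p^B • c = 0`: `N = B`.  This is the
local binder hbd of n1011-p06's (Lℓ) lemma and of n1011-p13's core-rank count, as a theorem.
[cite: MilneADT2006, Ch. I, Cor. 3.4 and Lemma 3.3] -/
theorem exists_pow_smul_eq_zero_galoisCohomology_localGaloisModule (hpv : ((p : ℕ) : 𝓞 K) ∉ v.asIdeal) :
    ∃ N : ℕ, ∀ c : galoisCohomology (W.localGaloisModule (v.adicCompletion K)) 1,
      (∃ j : ℕ, ((p ^ j : ℕ) : ℤ) • c = 0) → ((p ^ N : ℕ) : ℤ) • c = 0 := by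
  obtain ⟨B, hB, hle⟩ := exists_natCard_ker_nsmul_adicCompletion_le W v
  refine ⟨B, fun c ⟨j, hj⟩ => ?_⟩
  rw [natCast_zsmul] at hj ⊢
  -- the order of `c` is `p^i` with `i ≤ j`
  have hdvd : addOrderOf c ∣ p ^ j := addOrderOf_dvd_iff_nsmul_eq_zero.mpr hj
  obtain ⟨i, -, hi⟩ := (Nat.dvd_prime_pow hp.out).mp hdvd
  -- `p^i ≤ B`
  have hiB : p ^ i ≤ B := by
    cases i with
    | zero => rw [pow_zero]; exact hB
    | succ i' =>
      have hcT : c ∈ AddSubgroup.torsionBy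
          (galoisCohomology (W.localGaloisModule (v.adicCompletion K)) 1) ((p ^ (i' + 1) : ℕ) : ℤ) := by
        rw [AddSubgroup.torsionBy.nsmul_iff, ← hi]
        exact addOrderOf_nsmul_eq_zero c
      have hcard := natCard_torsionBy_galoisCohomology_localGaloisModule_eq_of_not_mem W v p hpv i'
      haveI : Finite (AddSubgroup.torsionBy
          (galoisCohomology (W.localGaloisModule (v.adicCompletion K)) 1) ((p ^ (i' + 1) : ℕ) : ℤ)) := by
        refine Nat.finite_of_card_ne_zero ?_
        rw [hcard]
        haveI := W.finite_ker_nsmul_adicCompletion v (pow_ne_zero (i' + 1) hp.out.ne_zero)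
        exact Nat.card_pos.ne'
      calc p ^ (i' + 1) = addOrderOf c := hi.symm
        _ = Nat.card (AddSubgroup.zmultiples c) := (Nat.card_zmultiples c).symm
        _ ≤ Nat.card (AddSubgroup.torsionBy
              (galoisCohomology (W.localGaloisModule (v.adicCompletion K)) 1)
              ((p ^ (i' + 1) : ℕ) : ℤ)) :=
            AddSubgroup.card_le_of_le ((AddSubgroup.zmultiples_le).mpr hcT)
        _ = _ := hcard
        _ ≤ B := hle _ (pow_ne_zero (i' + 1) hp.out.ne_zero)
  -- hence `i < B` and `p^B • c = 0`
  have hiB' : i ≤ B := ((Nat.lt_pow_self hp.out.one_lt).trans_le hiB).le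
  have hdvd' : addOrderOf c ∣ p ^ B := by
    rw [hi]
    exact pow_dvd_pow p hiB'
  exact addOrderOf_dvd_iff_nsmul_eq_zero.mp hdvd'

/-- **hbd over `ℚ`, in n1011-p06's spelling** (`Place.Completion (Sum.inr v : Place ℚ)` for the
completion): for `E/ℚ`, a prime `p` and a finite place `v ∤ p`, the `p`-power torsion of
`H¹(ℚ_v, E(ℚ̄_v))` has bounded exponent — the binder `hbd` of
`propagatedSelmerStructureOne_inr_eq_kummerSelmerStructure` (p06) and of
`hasCoreRank_one_propagatedSelmerStructureOne` (p13), VERBATIM, now a theorem.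
[cite: MilneADT2006, Ch. I, Cor. 3.4 and Lemma 3.3] -/
theorem bounded_pPrimaryTorsion_localGaloisModule_rat (W : WeierstrassCurve ℚ) [W.IsElliptic]
    (p : ℕ) [Fact p.Prime] {v : HeightOneSpectrum (𝓞 ℚ)} (hpv : ((p : ℕ) : 𝓞 ℚ) ∉ v.asIdeal) :
    ∃ N : ℕ, ∀ c : galoisCohomology (W.localGaloisModule
        (Place.Completion (Sum.inr v : Place ℚ))) 1,
      (∃ j : ℕ, ((p ^ j : ℕ) : ℤ) • c = 0) → ((p ^ N : ℕ) : ℤ) • c = 0 :=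
  exists_pow_smul_eq_zero_galoisCohomology_localGaloisModule W v p hpv

end Summit.BirchSwinnertonDyer.Rank1Residual.GaloisImage

end
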